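import Literature.NumberTheory.DiophantineGeometry.CatalanJacobiSum
import HarnessLib

/-!
# Stickelberger's theorem for the elements `f_i` on primes of degree one (Jacobi sums `J(χ, χ^i)`)

[Schoof2009, Theorem 9.5] (E. E. Kummer 1847 for `ℚ(ζ_p)`): for a prime `𝔩` of `ℤ[ζ_p]` of
degree one and every `θ` in the Stickelberger ideal, `𝔩^θ` is principal. `CatalanJacobiSum`
proves this for `ι θ₂ = ι f₁` via the Jacobi sum `J(χ, χ)`. Here we prove it for all the
generators `f_i = θ_{i+1} - θ_i = ∑_a m_{i,a} σ_a⁻¹`, `1 ≤ i ≤ p - 2`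
([Schoof2009, Proposition 9.2, Theorem 9.3]): with `m_{i,a} = [(i+1)a/p] - [ia/p] = 1` iff
`(ia mod p) + a ≥ p`,

* `Catalan.isPrincipal_prod_smul_filter_of_absNorm_prime` — for an ideal `𝔩` of prime norm
  `ℓ ≠ p` of a `p`-th cyclotomic field, `𝔩^{f_i} = ∏_{a : m_{i,a} = 1} σ_a⁻¹(𝔩)` is principal,
  generated by `ι J(χ, χ^i)` where `χ` is the `p`-th power residue character modulo `𝔩`
  (and `∏_{a : m_{i,a} = 0} σ_a⁻¹(𝔩) = (J(χ, χ^i))`).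

The proof is the one of `CatalanJacobiSum` with the exponent pair `(1, 1)` replaced by `(1, i)`:
`σ_c J(χ, χ^i) = J(χ^c, χ^{ic}) ≡ ∑_α α^{(c + (ic mod p))(ℓ-1)/p} (…) ≡ 0 (mod 𝔩)` exactly when
`c + (ic mod p) < p`, i.e. `m_{i,c} = 0`; the conjugates `σ_c⁻¹ 𝔩` are pairwise coprime; the
same for `ι J` and the complementary set (`m_{i,c} + m_{i,-c} = 1`, [Schoof2009, Prop. 9.4]);
and `(J)(ι J) = (ℓ) = ∏_{all c} σ_c⁻¹ 𝔩` (`jacobiSum_mul_jacobiSum_inv`). No named fact is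
introduced; no definitions.

## References

* R. Schoof, *Catalan's Conjecture*, Universitext, Springer 2009 [Schoof2009], Chapter 9
  (Proposition 9.2, Theorem 9.3, Proposition 9.4, Theorem 9.5; book pp. 55–60) — held,
  `lit read book:schoof2009-catalan-s-conjecture` (PDF pp. 139–146).
* K. Ireland, M. Rosen, *A Classical Introduction to Modern Number Theory*, GTM 84, Ch. 8, 11.
-/

namespace Literature.NumberTheory.DiophantineGeometry

namespace Catalan

open Finset NumberField

open scoped Pointwise

/-! ### The Galois action on Jacobi sums of two characters -/

section Character

variable {R : Type*} [CommRing R] {F : Type*} [Field F] [Fintype F]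

/-- If `σ` raises the values of `ψ₁` and `ψ₂` to the `c`-th power (`c ≥ 1`), then
`σ (J(ψ₁, ψ₂)) = J(ψ₁^c, ψ₂^c)`. [cite: Schoof2009, Exercise 9.6 (b)] -/
theorem smul_jacobiSum_eq_of_pow {G : Type*} [Group G] [MulSemiringAction G R] (σ : G)
    (ψ₁ ψ₂ : MulChar F R) {c : ℕ} (hc : c ≠ 0) (h₁ : ∀ α : F, σ • ψ₁ α = (ψ₁ α) ^ c)
    (h₂ : ∀ α : F, σ • ψ₂ α = (ψ₂ α) ^ c) :
    σ • jacobiSum ψ₁ ψ₂ = jacobiSum (ψ₁ ^ c) (ψ₂ ^ c) := by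
  classical
  rw [jacobiSum, jacobiSum, Finset.smul_sum]
  refine sum_congr rfl fun α _ => ?_
  rw [smul_mul', h₁, h₂, MulChar.pow_apply' ψ₁ hc, MulChar.pow_apply' ψ₂ hc]

end Character

/-! ### The complementary halves `m_{i,c} = 0` / `m_{i,c} = 1` -/

section Halves

variable {p : ℕ} [hp : Fact p.Prime]

/-- [Schoof2009, Proposition 9.4] in residue form: for `1 ≤ i ≤ p - 2` and a unit `c` mod `p`,
exactly one of `c`, `-c` satisfies `(i c mod p) + c ≥ p` (i.e. `m_{i,c} + m_{i,-c} = 1`).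
[cite: Schoof2009, Proposition 9.4] -/
theorem le_val_mul_add_val_iff_neg {i : ℕ} (hi1 : 1 ≤ i) (hi2 : i ≤ p - 2) (c : (ZMod p)ˣ) :
    p ≤ ((i : ZMod p) * c).val + (c : ZMod p).val ↔
      ¬ p ≤ ((i : ZMod p) * ↑(-c)).val + ((-c : (ZMod p)ˣ) : ZMod p).val := by
  haveI : NeZero p := ⟨hp.out.ne_zero⟩
  have hp2 := hp.out.two_le
  set v := (c : ZMod p).val with hv
  set w : ZMod p := (i : ZMod p) * c with hw
  have hc0 : (c : ZMod p) ≠ 0 := c.ne_zero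
  have hi0 : (i : ZMod p) ≠ 0 := by
    rw [Ne, ZMod.natCast_eq_zero_iff]
    exact fun h => by have := Nat.le_of_dvd (by omega) h; omega
  have hi1' : ((i + 1 : ℕ) : ZMod p) ≠ 0 := by
    rw [Ne, ZMod.natCast_eq_zero_iff]
    exact fun h => by have := Nat.le_of_dvd (by omega) h; omega
  have hw0 : w ≠ 0 := mul_ne_zero hi0 hc0
  have hvp : v < p := ZMod.val_lt _
  have hwp : w.val < p := ZMod.val_lt _
  have hv0 : 0 < v := by
    rw [hv, Nat.pos_iff_ne_zero, Ne, ZMod.val_eq_zero]; exact hc0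
  have hwv0 : 0 < w.val := by
    rw [Nat.pos_iff_ne_zero, Ne, ZMod.val_eq_zero]; exact hw0
  have hne : w.val + v ≠ p := by
    intro h
    have h1 : (((i + 1 : ℕ) : ZMod p) * c).val = 0 := by
      rw [Nat.cast_add, Nat.cast_one, add_mul, one_mul, ZMod.val_add, ← hw, ← hv, h, Nat.mod_self]
    rw [ZMod.val_eq_zero] at h1
    exact mul_ne_zero hi1' hc0 h1
  have hnegv : ((-c : (ZMod p)ˣ) : ZMod p).val = p - v := by
    rw [Units.val_neg, ZMod.neg_val, if_neg hc0]
  have hnegw : ((i : ZMod p) * ((-c : (ZMod p)ˣ) : ZMod p)).val = p - w.val := by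
    rw [Units.val_neg, mul_neg, ← hw, ZMod.neg_val, if_neg hw0]
  rw [hnegv, hnegw]
  omega

end Halves

/-! ### Stickelberger's theorem for `f_i` on primes of degree one -/

section Cyclotomic

variable {p : ℕ} [hp : Fact p.Prime] {K : Type*} [Field K] [NumberField K]
  [IsCyclotomicExtension {p} ℚ K]

/-- **Stickelberger's theorem for `f_i = θ_{i+1} - θ_i = ∑_a m_{i,a} σ_a⁻¹`, on primes of
degree one** ([Schoof2009, Theorem 9.5], E. E. Kummer 1847; Jacobi-sum form). Let `p` be an
odd prime, `K` a `p`-th cyclotomic field, `𝔩` an ideal of `𝓞 K = ℤ[ζ_p]` of prime norm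
`ℓ ≠ p`, and `1 ≤ i ≤ p - 2`. Then `𝔩^{f_i} = ∏_{a : m_{i,a} = 1} σ_a⁻¹(𝔩)` is principal; here
`m_{i,a} = [(i+1)a/p] - [ia/p] = 1` iff `(ia mod p) + a ≥ p` (`a ∈ [1, p-1]`). It is generated
by `ι J(χ, χ^i)`, `χ` the `p`-th power residue character modulo `𝔩`.
[cite: Schoof2009, Theorem 9.5] -/
theorem isPrincipal_prod_smul_filter_of_absNorm_prime (hpo : Odd p) {ζ : K}
    (hζ : IsPrimitiveRoot ζ p) (𝔩 : Ideal (𝓞 K)) (hprime : (Ideal.absNorm 𝔩).Prime)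
    (hne : Ideal.absNorm 𝔩 ≠ p) {i : ℕ} (hi1 : 1 ≤ i) (hi2 : i ≤ p - 2) :
    (∏ a ∈ Finset.univ.filter
        (fun a : (ZMod p)ˣ => p ≤ ((i : ZMod p) * a).val + (a : ZMod p).val),
      (IsCyclotomicExtension.Rat.galEquivZMod p K).symm a⁻¹ • 𝔩).IsPrincipal := by
  classical
  -- ### Setup: the residue field `F = 𝓞 K ⧸ 𝔩` of prime order `ℓ`
  haveI : Fact (1 < p) := ⟨hp.out.one_lt⟩
  haveI : NeZero p := ⟨hp.out.ne_zero⟩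
  have hp3 : 3 ≤ p := by
    have := hp.out.two_le
    obtain ⟨k, hk⟩ := hpo
    omega
  have hip : i < p := by omega
  have hi1p : i + 1 < p := by omega
  set ℓ := Ideal.absNorm 𝔩 with hℓdef
  haveI h𝔩p : 𝔩.IsPrime :=
    Ideal.isPrime_of_irreducible_absNorm ((Nat.irreducible_iff_nat_prime _).mpr hprime)
  have h𝔩0 : 𝔩 ≠ ⊥ := by
    rintro rfl
    rw [hℓdef, Ideal.absNorm_bot] at hprime
    exact Nat.not_prime_zero hprime
  haveI h𝔩m : 𝔩.IsMaximal := h𝔩p.isMaximal h𝔩0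
  letI : Field (𝓞 K ⧸ 𝔩) := Ideal.Quotient.field 𝔩
  letI : Fintype (𝓞 K ⧸ 𝔩) := Fintype.ofFinite _
  have hcardF : Fintype.card (𝓞 K ⧸ 𝔩) = ℓ := by
    rw [hℓdef, Ideal.absNorm_apply, Submodule.cardQuot_apply, Nat.card_eq_fintype_card]
  haveI : Fact ℓ.Prime := ⟨hprime⟩
  have hℓp : ℓ.Coprime p := (Nat.coprime_primes hprime hp.out).mpr hne
  haveI : 𝔩.LiesOver (Ideal.span {(ℓ : ℤ)}) :=
    ⟨by rw [Ideal.under_def, ← Ideal.span_singleton_absNorm hprime]⟩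
  -- `ζ` stays a primitive `p`-th root of unity modulo `𝔩`; hence `p ∣ ℓ - 1`
  set z : 𝓞 K := hζ.toInteger with hzdef
  have hz : IsPrimitiveRoot z p := hζ.toInteger_isPrimitiveRoot
  set φ : 𝓞 K →+* 𝓞 K ⧸ 𝔩 := Ideal.Quotient.mk 𝔩 with hφdef
  have hzφ : IsPrimitiveRoot (φ z) p := hz.idealQuotient_mk hprime.one_lt.ne' hℓp
  -- ### The character and its Jacobi sums
  obtain ⟨χ, hχ, hχval⟩ := exists_mulChar_apply_eq_pow φ hz hzφ
  set d := (Fintype.card (𝓞 K ⧸ 𝔩) - 1) / p with hddef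
  have hpd : p ∣ Fintype.card (𝓞 K ⧸ 𝔩) - 1 := by
    have hu := hzφ.isUnit hp.out.ne_zero
    have h1 : IsPrimitiveRoot hu.unit p := IsPrimitiveRoot.coe_units_iff.mp (by simpa using hzφ)
    rw [← Fintype.card_units, h1.eq_orderOf]
    exact orderOf_dvd_card
  have hdp : d * p = Fintype.card (𝓞 K ⧸ 𝔩) - 1 := Nat.div_mul_cancel hpd
  have hd0 : 0 < d := by
    rw [Nat.pos_iff_ne_zero]
    intro hd0
    rw [hd0, zero_mul] at hdp
    have := Fintype.one_lt_card (α := 𝓞 K ⧸ 𝔩)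
    omega
  -- values of `χ` are `p`-th roots of unity (or `0`), so the Galois group acts by `χ ↦ χ^c`
  have hχp : ∀ α : 𝓞 K ⧸ 𝔩, χ α ^ p = 1 ∨ χ α = 0 := by
    intro α
    by_cases hα : IsUnit α
    · obtain ⟨m, hm⟩ := hχval hα.unit
      rw [IsUnit.unit_spec] at hm
      left
      rw [hm, ← pow_mul, mul_comm, pow_mul, hz.pow_eq_one, one_pow]
    · right
      exact MulChar.map_nonunit χ hα
  have hχpow : χ ^ p = 1 := by
    refine MulChar.ext fun u => ?_
    rw [MulChar.pow_apply_coe, MulChar.one_apply_coe]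
    rcases hχp u with h | h
    · exact h
    · exact absurd h (by rw [← MulChar.coe_toUnitHom]; exact Units.ne_zero _)
  -- `χ ^ n` only depends on `n mod p`
  have hχmod : ∀ n : ℕ, χ ^ n = χ ^ (n % p) := by
    intro n
    conv_lhs => rw [← Nat.mod_add_div n p, pow_add, pow_mul, hχpow, one_pow, mul_one]
  set σ_ := (IsCyclotomicExtension.Rat.galEquivZMod p K).symm with hσdef
  have hσval : ∀ (c : (ZMod p)ˣ) (α : 𝓞 K ⧸ 𝔩), σ_ c • χ α = χ α ^ (c : ZMod p).val := by
    intro c α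
    rcases hχp α with h1 | h0
    · rw [IsCyclotomicExtension.Rat.galEquivZMod_smul_of_pow_eq p K _ h1, hσdef,
        MulEquiv.apply_symm_apply]
    · rw [h0, smul_zero, zero_pow]
      rw [Ne, ZMod.val_eq_zero]
      exact c.ne_zero
  have hval0 : ∀ c : (ZMod p)ˣ, (c : ZMod p).val ≠ 0 := fun c => by
    rw [Ne, ZMod.val_eq_zero]; exact c.ne_zero
  -- the unit `i` and the exponents `v(ic) = (i c) mod p`
  have hi0 : (i : ZMod p) ≠ 0 := by
    rw [Ne, ZMod.natCast_eq_zero_iff]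
    exact fun h => by have := Nat.le_of_dvd (by omega) h; omega
  have hvali0 : ∀ c : (ZMod p)ˣ, ((i : ZMod p) * c).val ≠ 0 := fun c => by
    rw [Ne, ZMod.val_eq_zero]; exact mul_ne_zero hi0 c.ne_zero
  have hvali : ∀ c : (ZMod p)ˣ, ((i : ZMod p) * c).val = (i * (c : ZMod p).val) % p := fun c => by
    rw [ZMod.val_mul, ZMod.val_natCast, Nat.mod_mul_mod]
  set J : 𝓞 K := jacobiSum χ (χ ^ i) with hJdef
  -- `σ_c J = J(χ^c, χ^{ic})`, which lies in `𝔩` when `c + (ic mod p) < p`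
  have hσχi : ∀ (c : (ZMod p)ˣ) (α : 𝓞 K ⧸ 𝔩),
      σ_ c • (χ ^ i) α = ((χ ^ i) α) ^ (c : ZMod p).val := by
    intro c α
    rw [MulChar.pow_apply' χ (by omega : i ≠ 0), smul_pow', hσval, ← pow_mul, ← pow_mul, mul_comm]
  have hσJ : ∀ c : (ZMod p)ˣ,
      σ_ c • J = jacobiSum (χ ^ (c : ZMod p).val) (χ ^ ((i : ZMod p) * c).val) := by
    intro c
    rw [hJdef, smul_jacobiSum_eq_of_pow (σ_ c) χ (χ ^ i) (hval0 c) (hσval c) (hσχi c),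
      ← pow_mul, hχmod (i * _), hvali]
  have hJmem : ∀ c : (ZMod p)ˣ, ¬ p ≤ ((i : ZMod p) * c).val + (c : ZMod p).val →
      σ_ c • J ∈ 𝔩 := by
    intro c hc
    rw [hσJ c, ← Ideal.Quotient.eq_zero_iff_mem]
    refine map_jacobiSum_pow_pow_eq_zero φ hχ (hval0 c) (hvali0 c) ?_
    rw [← hdp]
    have : (c : ZMod p).val + ((i : ZMod p) * c).val < p := by omega
    nlinarith
  -- ### The conjugates `σ_{c⁻¹} 𝔩` are pairwise distinct: the decomposition group is trivial
  have hstab : ∀ τ : K ≃ₐ[ℚ] K, τ • 𝔩 = 𝔩 → τ = 1 := by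
    intro τ hτ
    have hmem := IsCyclotomicExtension.Rat.mem_zpowers_galEquivZMod_of_mem_stabilizer p K ℓ 𝔩 hℓp
      (MulAction.mem_stabilizer_iff.mpr hτ)
    have h1 : ZMod.unitOfCoprime ℓ hℓp = 1 := by
      apply Units.ext
      rw [ZMod.coe_unitOfCoprime, Units.val_one, ← hcardF, ← Nat.sub_add_cancel
        Fintype.card_pos, ← hdp, Nat.cast_add, Nat.cast_mul, ZMod.natCast_self, mul_zero,
        zero_add, Nat.cast_one]
    rw [h1, Subgroup.zpowers_one_eq_bot, Subgroup.mem_bot] at hmem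
    exact (MulEquiv.map_eq_one_iff _).mp hmem
  have hinj : ∀ c₁ c₂ : (ZMod p)ˣ, σ_ c₁ • 𝔩 = σ_ c₂ • 𝔩 → c₁ = c₂ := by
    intro c₁ c₂ h
    have : (σ_ c₂)⁻¹ * σ_ c₁ = 1 := hstab _ (by rw [mul_smul, h, inv_smul_smul])
    rw [inv_mul_eq_one] at this
    exact σ_.injective this.symm
  -- ### Divisibility: `T ∣ (J)` and `T' ∣ (ι J)`, with `T T' = (ℓ)`
  set P : (ZMod p)ˣ → Prop := fun a => p ≤ ((i : ZMod p) * a).val + (a : ZMod p).val with hPdef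
  set S₀ := Finset.univ.filter (fun a : (ZMod p)ˣ => ¬ P a) with hS₀def
  set S₁ := Finset.univ.filter (fun a : (ZMod p)ˣ => P a) with hS₁def
  have hmax : ∀ τ : K ≃ₐ[ℚ] K, (τ • 𝔩).IsMaximal := fun τ => by
    haveI : (τ • 𝔩).IsPrime := Ideal.IsPrime.smul τ
    refine Ideal.IsPrime.isMaximal inferInstance ?_
    rw [Ideal.pointwise_smul_def]
    exact (Ideal.map_eq_bot_iff_of_injective
      (MulSemiringAction.toRingEquiv _ (𝓞 K) τ).injective).not.mpr h𝔩0
  have hcopr : ∀ T : Finset (ZMod p)ˣ,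
      (T : Set (ZMod p)ˣ).Pairwise (Function.onFun IsCoprime fun a => σ_ a⁻¹ • 𝔩) := by
    intro T a _ b _ hab
    exact Ideal.isCoprime_iff_sup_eq.mpr ((hmax _).coprime_of_ne (hmax _)
      fun h => hab (inv_injective (hinj _ _ h)))
  have hσnat : ∀ (τ : K ≃ₐ[ℚ] K) (n : ℕ), τ • (n : 𝓞 K) = n := fun τ n => by
    rw [← MulSemiringAction.toRingHom_apply, map_natCast]
  -- `T ∣ (J)`
  have hT : ∏ a ∈ S₀, σ_ a⁻¹ • 𝔩 ∣ Ideal.span {J} := by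
    refine Finset.prod_dvd_of_coprime (hcopr S₀) fun a ha => ?_
    rw [Ideal.dvd_span_singleton, map_inv, Ideal.mem_inv_pointwise_smul_iff]
    exact hJmem a (Finset.mem_filter.mp ha).2
  -- `T' ∣ (ι J)`
  set J' : 𝓞 K := σ_ (-1) • J with hJ'def
  have hT' : ∏ a ∈ S₁, σ_ a⁻¹ • 𝔩 ∣ Ideal.span {J'} := by
    refine Finset.prod_dvd_of_coprime (hcopr S₁) fun a ha => ?_
    rw [Ideal.dvd_span_singleton, map_inv, Ideal.mem_inv_pointwise_smul_iff, hJ'def, ← mul_smul,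
      ← map_mul, mul_neg_one]
    refine hJmem (-a) ?_
    have haP : P a := (Finset.mem_filter.mp ha).2
    exact (le_val_mul_add_val_iff_neg hi1 hi2 a).mp haP
  -- `∏_{all c} σ_{c} 𝔩 = (ℓ)` by comparing norms
  have hnorm𝔩 : ∀ τ : K ≃ₐ[ℚ] K, Ideal.absNorm (τ • 𝔩) = ℓ := fun τ => by
    rw [absNorm_smul, hℓdef]
  have hrank : Module.finrank ℤ (𝓞 K) = p - 1 := by
    rw [RingOfIntegers.rank, IsCyclotomicExtension.Rat.finrank p K, Nat.totient_prime hp.out]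
  have hnormℓ : Ideal.absNorm (Ideal.span {(ℓ : 𝓞 K)}) = ℓ ^ (p - 1) := by
    rw [Ideal.absNorm_span_singleton, ← map_natCast (algebraMap ℤ (𝓞 K)), Algebra.norm_algebraMap,
      hrank, Int.natAbs_pow, Int.natAbs_natCast]
  have hN : ∏ c : (ZMod p)ˣ, σ_ c • 𝔩 = Ideal.span {(ℓ : 𝓞 K)} := by
    have hcopr' : ((Finset.univ : Finset (ZMod p)ˣ) : Set (ZMod p)ˣ).Pairwise
        (Function.onFun IsCoprime fun a => σ_ a • 𝔩) := by
      intro a _ b _ hab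
      exact Ideal.isCoprime_iff_sup_eq.mpr ((hmax _).coprime_of_ne (hmax _)
        fun h => hab (hinj _ _ h))
    have hdvd : ∏ c : (ZMod p)ˣ, σ_ c • 𝔩 ∣ Ideal.span {(ℓ : 𝓞 K)} := by
      refine Finset.prod_dvd_of_coprime hcopr' fun c _ => ?_
      rw [Ideal.dvd_span_singleton]
      have := Ideal.smul_mem_pointwise_smul (σ_ c) _ 𝔩 (Ideal.absNorm_mem 𝔩)
      rwa [hσnat] at this
    obtain ⟨U, hU⟩ := hdvd
    have hnormU : Ideal.absNorm U = 1 := by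
      have h1 := congrArg Ideal.absNorm hU
      rw [hnormℓ, map_mul, map_prod] at h1
      simp only [hnorm𝔩, prod_const, card_univ, ZMod.card_units_eq_totient,
        Nat.totient_prime hp.out] at h1
      exact (mul_eq_left₀ (pow_ne_zero _ hprime.ne_zero)).mp h1.symm
    rw [Ideal.absNorm_eq_one_iff] at hnormU
    rw [hU, hnormU, Ideal.mul_top]
  -- ### `J · J' = ℓ` (in `K`, by `jacobiSum_mul_jacobiSum_inv`)
  have hχ1 : ∀ a : ℕ, 0 < a → a < p → χ ^ a ≠ 1 := by
    intro a ha0 hap h1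
    obtain ⟨g, hg⟩ := IsCyclic.exists_generator (α := (𝓞 K ⧸ 𝔩)ˣ)
    have hg1 : ((g : 𝓞 K ⧸ 𝔩) ^ (d * a)) = 1 := by
      have := congrArg (fun ψ : MulChar (𝓞 K ⧸ 𝔩) (𝓞 K) => φ (ψ g)) h1
      rwa [MulChar.pow_apply' χ ha0.ne', map_pow, hχ, ← pow_mul, MulChar.one_apply_coe,
        map_one] at this
    have hord : orderOf g = d * p := by
      rw [orderOf_eq_card_of_forall_mem_zpowers hg, Nat.card_eq_fintype_card, Fintype.card_units,
        ← hdp]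
    have hdvd : d * p ∣ d * a := by
      rw [← hord, orderOf_dvd_iff_pow_eq_one, Units.ext_iff, Units.val_pow_eq_pow_val, hg1,
        Units.val_one]
    have : p ∣ a := Nat.dvd_of_mul_dvd_mul_left hd0 hdvd
    exact absurd (Nat.le_of_dvd ha0 this) (not_le.mpr hap)
  have hJJ' : J * J' = (ℓ : 𝓞 K) := by
    have hinjK := FaithfulSMul.algebraMap_injective (𝓞 K) K
    apply hinjK
    set χK := χ.ringHomComp (algebraMap (𝓞 K) K) with hχKdef
    have hne1 : χK ≠ 1 := (MulChar.ringHomComp_ne_one_iff hinjK).mpr (by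
      simpa using hχ1 1 one_pos (by omega))
    have hnei : χK ^ i ≠ 1 := by
      rw [hχKdef, MulChar.ringHomComp_pow, MulChar.ringHomComp_ne_one_iff hinjK]
      exact hχ1 i (by omega) hip
    have hnei1 : χK * χK ^ i ≠ 1 := by
      rw [← pow_succ', hχKdef, MulChar.ringHomComp_pow, MulChar.ringHomComp_ne_one_iff hinjK]
      exact hχ1 (i + 1) (by omega) hi1p
    have hchar : ringChar K ≠ ringChar (𝓞 K ⧸ 𝔩) := by
      rw [ringChar.eq_zero, ne_comm]
      haveI : CharP (𝓞 K ⧸ 𝔩) (ringChar (𝓞 K ⧸ 𝔩)) := ringChar.charP _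
      obtain ⟨n, hpr, -⟩ := FiniteField.card (𝓞 K ⧸ 𝔩) (ringChar (𝓞 K ⧸ 𝔩))
      exact hpr.ne_zero
    have hmain := jacobiSum_mul_jacobiSum_inv hchar hne1 hnei hnei1
    rw [hχKdef, MulChar.ringHomComp_pow, MulChar.ringHomComp_inv, MulChar.ringHomComp_inv,
      jacobiSum_ringHomComp, jacobiSum_ringHomComp, hcardF] at hmain
    rw [map_mul, map_natCast]
    -- `J' = J(χ⁻¹, (χ^i)⁻¹)` as `χ⁻¹ = χ^(p-1)` and `(χ^i)⁻¹ = χ^(p-i)`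
    have hvneg1 : ((-1 : (ZMod p)ˣ) : ZMod p).val + 1 = p := by
      rw [Units.val_neg, Units.val_one, ZMod.val_neg_of_ne_zero, ZMod.val_one]; omega
    have hχinv : χ ^ ((-1 : (ZMod p)ˣ) : ZMod p).val = χ⁻¹ := by
      refine (inv_eq_of_mul_eq_one_left ?_).symm
      rw [← pow_succ, hvneg1, hχpow]
    have hvnegi : ((i : ZMod p) * ((-1 : (ZMod p)ˣ) : ZMod p)).val + i = p := by
      rw [Units.val_neg, Units.val_one, mul_neg_one, ZMod.neg_val, if_neg hi0, ZMod.val_natCast,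
        Nat.mod_eq_of_lt hip]
      omega
    have hχinvi : χ ^ ((i : ZMod p) * ((-1 : (ZMod p)ˣ) : ZMod p)).val = (χ ^ i)⁻¹ := by
      refine (inv_eq_of_mul_eq_one_left ?_).symm
      rw [← pow_add, hvnegi, hχpow]
    have hJ'eq : J' = jacobiSum χ⁻¹ (χ ^ i)⁻¹ := by rw [hJ'def, hσJ (-1), hχinv, hχinvi]
    rw [hJ'eq]
    exact hmain
  -- ### Conclusion: `T T' = (ℓ) = (J)(J')` with `T ∣ (J)`, `T' ∣ (J')` forces `T' = (J')`
  have hTT' : (∏ a ∈ S₀, σ_ a⁻¹ • 𝔩) * (∏ a ∈ S₁, σ_ a⁻¹ • 𝔩)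
      = Ideal.span {J} * Ideal.span {J'} := by
    rw [Ideal.span_singleton_mul_span_singleton, hJJ', ← hN, hS₀def, hS₁def, mul_comm,
      Finset.prod_filter_mul_prod_filter_not]
    exact Equiv.prod_comp (Equiv.inv (ZMod p)ˣ) (fun u => σ_ u • 𝔩)
  obtain ⟨U, hU⟩ := hT
  obtain ⟨U', hU'⟩ := hT'
  have hTT'0 : (∏ a ∈ S₀, σ_ a⁻¹ • 𝔩) * (∏ a ∈ S₁, σ_ a⁻¹ • 𝔩) ≠ 0 := by
    rw [hTT', Ideal.span_singleton_mul_span_singleton, hJJ', Ne, Ideal.zero_eq_bot,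
      Ideal.span_singleton_eq_bot]
    exact_mod_cast hprime.ne_zero
  have hUU' : U * U' = 1 := by
    apply mul_left_cancel₀ hTT'0
    conv_rhs => rw [mul_one, hTT', hU, hU']
    ring
  have hU'1 : U' = ⊤ := Ideal.isUnit_iff.mp (IsUnit.of_mul_eq_one_right U hUU')
  rw [hU'1, Ideal.mul_top] at hU'
  exact ⟨⟨J', hU'.symm⟩⟩

end Cyclotomic

end Catalan

end Literature.NumberTheory.DiophantineGeometry
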